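import Summits.AtomisticToContinuum.HydrodynamicLimit.Theorems.AntiMazurCoboundariesCorrectorPressureDecayKiferCanonicalLocalLimitClosure

/-!
# The canonical local limit, V: intensity of the x-averaged blown-up canonical laws (line `FirstLemma`, crux stmt-AtomisticToContinuum-14135)

Registered stub `stub_canonicalBlowUpIntensity` (E1-i) of skeleton v10 of line `FirstLemma`, namespace
`Summit.AtomisticToContinuum.HydrodynamicLimit.Theorems.KiferCompactification`: the INTENSITY input of the
compactness half (E1) `CanonicalBlowUpLocallyCompact` of the decomposition of Georgii's named fact
(`…KiferCanonicalLocalLimit.lean`), used in `exists_canonicalLocalLimit_of_stubs`.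

* `lintegral_count_canonicalBlowUpLaw`: the mean number of points of the x-averaged blown-up canonical law
  `canonicalBlowUpLaw σ a θ u₀ N Φ` with position in a measurable `B ⊆ ℝ³` is EXACTLY
  `(N+1) · vol(ε_N B ∩ (-1/2, 1/2]³)`, `ε_N = hsDiameter σ N` (Fubini and the torus average
  `lintegral_count_blowUp_window` of `…Basics.lean`, the canonical law being carried by the hard-sphere domain);
* `stub_canonicalBlowUpIntensity`: hence it is at most `σ³ · vol B`, since `vol(ε_N B) = ε_N³ vol B` and
  `(N+1) ε_N³ = σ³` (`succ_mul_hsDiameter_pow_three`).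

References: H.-O. Georgii, J. Stat. Phys. 80 (1995) §3; S. Olla, S. R. S. Varadhan, H.-T. Yau, Comm. Math. Phys. 155
(1993) §4 (the blow-up).
-/

noncomputable section

open MeasureTheory Set Filter Topology Function
open scoped ENNReal NNReal

namespace Summit.AtomisticToContinuum.HydrodynamicLimit.Theorems.KiferCompactification

open Literature.MathematicalPhysics.KineticTheory (T3 V3 hsDiameter hsDiameter_pos localGibbsLaw blowUp
  succ_mul_hsDiameter_pow_three isProbabilityMeasure_localGibbsLaw)
open Literature.MathematicalPhysics.KineticTheory.PointProcess (measurable_count_window)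
open Literature.Analysis.FluidPDE (HardSphereFlow Config)
open Literature.Analysis.FunctionSpaces (PointConfig)
open Literature.Analysis.FluidPDE.Torus (symCube)

/-- **Mean window counts of the x-averaged blown-up canonical law, exactly.** For `σ > 0`, `σ ≤ 1/2`, `a, θ > 0`
and a measurable `B ⊆ ℝ³`, the mean number of points of `canonicalBlowUpLaw σ a θ u₀ N Φ` with position in `B` is
`(N+1) · vol(ε_N B ∩ (-1/2, 1/2]³)`, `ε_N = hsDiameter σ N`: Fubini over `dx ⊗ localGibbsLaw`, then the torus
average `lintegral_count_blowUp_window` for (almost) every configuration of the hard-sphere domain. -/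
theorem lintegral_count_canonicalBlowUpLaw {σ a θ : ℝ} (u₀ : V3) (hσ : 0 < σ) (hσ2 : σ ≤ 1 / 2) (ha : 0 < a)
    (hθ : 0 < θ) (N : ℕ)
    (Φ : HardSphereFlow (Literature.Analysis.FluidPDE.Torus.geometry (Fin 3)) (hsDiameter σ N) (N + 1))
    {B : Set V3} (hB : MeasurableSet B) :
    ∫⁻ ω, ((ω.count (Prod.fst ⁻¹' B) : ℕ∞) : ℝ≥0∞) ∂(canonicalBlowUpLaw σ a θ u₀ N Φ) =
      ((N + 1 : ℕ) : ℝ≥0∞) * volume ((fun y : V3 => (hsDiameter σ N)⁻¹ • y) ⁻¹' B ∩ symCube (Fin 3)) := by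
  haveI : IsProbabilityMeasure (volume : Measure T3) := by rw [volume_pi]; infer_instance
  haveI := isProbabilityMeasure_localGibbsLaw (a₀ := fun _ => a) (θ₀ := fun _ => θ) (u₀ := fun _ => u₀)
    continuous_const continuous_const continuous_const (fun _ => ha) (fun _ => hθ) hσ2 N Φ
  have hcnt : Measurable fun ω : PointConfig (V3 × V3) => ((ω.count (Prod.fst ⁻¹' B) : ℕ∞) : ℝ≥0∞) :=
    measurable_count_window hB
  have hmeas : Measurable fun p : T3 × Config (N + 1) (Fin 3) T3 =>
      (((blowUp (hsDiameter σ N) p.1 p.2).count (Prod.fst ⁻¹' B) : ℕ∞) : ℝ≥0∞) :=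
    hcnt.comp (measurable_blowUp (hsDiameter σ N) (N + 1))
  rw [canonicalBlowUpLaw, lintegral_map hcnt (measurable_blowUp (hsDiameter σ N) (N + 1)),
    lintegral_prod_symm _ hmeas.aemeasurable]
  have hae : ∀ᵐ z ∂(localGibbsLaw σ (fun _ => a) (fun _ => u₀) (fun _ => θ) N Φ),
      ∫⁻ x : T3, (((blowUp (hsDiameter σ N) x z).count (Prod.fst ⁻¹' B) : ℕ∞) : ℝ≥0∞) =
        ((N + 1 : ℕ) : ℝ≥0∞) * volume ((fun y : V3 => (hsDiameter σ N)⁻¹ • y) ⁻¹' B ∩ symCube (Fin 3)) := by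
    filter_upwards [ae_mem_hardSphereDomain_localGibbsLaw σ _ _ _ N Φ] with z hz
    rw [lintegral_count_blowUp_window (hsDiameter_pos hσ N) hz hB]
  rw [lintegral_congr_ae hae, lintegral_const, measure_univ, mul_one]

/-- **Lebesgue measure of a rescaled set**: `vol {y | ε⁻¹ y ∈ B} = ε³ vol B` on `ℝ³` (`ε > 0`). -/
theorem volume_preimage_inv_smul {ε : ℝ} (hε : 0 < ε) (B : Set V3) :
    volume ((fun y : V3 => ε⁻¹ • y) ⁻¹' B) = ENNReal.ofReal (ε ^ 3) * volume B := by
  rw [Measure.addHaar_preimage_smul volume (inv_ne_zero hε.ne') B, finrank_euclideanSpace_fin, inv_pow, inv_inv,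
    abs_of_pos (pow_pos hε 3)]

/-- (E1-i) **INTENSITY OF THE BLOW-UPS.** The x-averaged blown-up canonical law of `N + 1` spheres at reduced
diameter `0 < σ ≤ 1/2` (constant profiles `a, θ > 0`, drift `u₀`) has intensity at most `σ³ · Leb`: the mean number
of points with position in a measurable `B ⊆ ℝ³` is `(N+1) vol(ε_N B ∩ (-1/2,1/2]³) ≤ (N+1) ε_N³ vol B = σ³ vol B`.
Registered stub of skeleton v10 of line `FirstLemma` (crux stmt-AtomisticToContinuum-14135). -/
theorem stub_canonicalBlowUpIntensity : ∀ (σ a θ : ℝ) (u₀ : V3), 0 < σ → σ ≤ 1 / 2 → 0 < a → 0 < θ →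
    ∀ (N : ℕ) (Φ : HardSphereFlow (Literature.Analysis.FluidPDE.Torus.geometry (Fin 3)) (hsDiameter σ N) (N + 1))
      (B : Set V3), MeasurableSet B →
      ∫⁻ ω, ((ω.count (Prod.fst ⁻¹' B) : ℕ∞) : ℝ≥0∞) ∂(canonicalBlowUpLaw σ a θ u₀ N Φ) ≤
        ENNReal.ofReal (σ ^ 3) * volume B := by
  intro σ a θ u₀ hσ hσ2 ha hθ N Φ B hB
  rw [lintegral_count_canonicalBlowUpLaw u₀ hσ hσ2 ha hθ N Φ hB]
  calc ((N + 1 : ℕ) : ℝ≥0∞) * volume ((fun y : V3 => (hsDiameter σ N)⁻¹ • y) ⁻¹' B ∩ symCube (Fin 3))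
      ≤ ((N + 1 : ℕ) : ℝ≥0∞) * volume ((fun y : V3 => (hsDiameter σ N)⁻¹ • y) ⁻¹' B) := by
        gcongr
        exact inter_subset_left
    _ = ENNReal.ofReal (((N + 1 : ℕ) : ℝ) * hsDiameter σ N ^ 3) * volume B := by
        rw [volume_preimage_inv_smul (hsDiameter_pos hσ N), ← mul_assoc, ENNReal.ofReal_mul (Nat.cast_nonneg _),
          ENNReal.ofReal_natCast]
    _ = ENNReal.ofReal (σ ^ 3) * volume B := by rw [succ_mul_hsDiameter_pow_three]

end Summit.AtomisticToContinuum.HydrodynamicLimit.Theorems.KiferCompactification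

end
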